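import Literature.Barriers.AtomisticToContinuum.HalfFillingDischarges
import Literature.MathematicalPhysics.QuantumLattice.XYOrderGDProofs
import Literature.MathematicalPhysics.QuantumLattice.KroneckerTraceSchwarz
import Literature.MathematicalPhysics.QuantumLattice.DuhamelTwoPoint
import Mathlib.Topology.Instances.Matrix
import HarnessLib

/-!
# Hard-core lattice bosons at half filling: Gaussian domination at positive temperature

`Literature/Barriers/AtomisticToContinuum`; sibling proof file of `HalfFillingThermalKLS.lean`
(item `provefact-Literature.Barriers.AtomisticToContinuum.HalfFillingReflectionPositivity`, fact
(Aᵀ) `hc_infraredBound_thermal`). No statement is introduced or changed. This file proves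
**Gaussian domination for the Gibbs state of the hard-core lattice gas**
([LSSY2005] Ch. 11 (11.12); [DLS1978] Thm. 4.2): for the field Hamiltonian
`H(h) = H - Σ_{⟨xy⟩}(h_x - h_y)(S¹_x - S¹_y) + ½Σ_{⟨xy⟩}(h_x - h_y)²`, `H = hardCoreLatticeGas d L λ`
([LSSY2005] (11.2)), on the even torus `(ℤ/Lℤ)^d`, `L ≥ 4`, and every `β > 0`,
`Z_β(H(h)) ≤ Z_β(H)` (`hc_partitionFn_field_le`).

## The proof ([LSSY2005] (11.13)–(11.20); [DLS1978] Lemma 4.1, Thm. 4.2)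

* The sublattice rotation by `π` about the `1`-axis (the `W` of `XYOrderGDProofs`) maps `H(h)`
  to `H♭(h) + λΣ_x(½ + S³_x)`: the XY part becomes the real, bond-reflection-positive
  `xyRealFieldHamiltonian`, and the *staggered* field `λΣ(-1)^xS³_x` becomes the *uniform* field
  `λΣS³_x`, a real, reflection-symmetric one-body term (`exists_unitary_conj_hcField`).
* Along every pair of planes the rotated Hamiltonian has the Kronecker form
  `(A + λF) ⊗ 1 + 1 ⊗ (B + λF) - ΣᵢMᵢ⊗Nᵢ` with `A, B, Mᵢ, Nᵢ` those of `XYOrderGDProofs` and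
  `F = Σ_{y ∈ left}(½ + S³_y)` (`uniformField_eq_embed`).
* The Dyson–Lieb–Simon trace inequality `Matrix.trace_exp_kroneckerSum_le`
  (`KroneckerTraceSchwarz.lean`, [DLS1978] Lemma 4.1) gives the reflection inequality
  **`Z(h)² ≤ Z(h^L) Z(h^R)`** (`partitionFn_hcField_sq_le`; [LSSY2005] (11.19)).
* The descent of [LSSY2005] after (11.20) / [DLS1978] proof of Thm. 4.2: maximise `Z` over the
  finitely many fields with values in the range of `h`, then minimise the number of bonds with
  `h_x ≠ h_y`; a bad bond and the planes through it contradict `badBondCount_reflect`.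

## References

* [LSSY2005] E. H. Lieb, R. Seiringer, J. P. Solovej, J. Yngvason, *The Mathematics of the Bose
  Gas and its Condensation* (2005), Ch. 11, (11.2), (11.10)–(11.20).
* [DLS1978] F. J. Dyson, E. H. Lieb, B. Simon, J. Stat. Phys. 18 (1978) 335–383, Lemma 4.1,
  Theorem 4.2.
* [KLS1988JSP] T. Kennedy, E. H. Lieb, B. S. Shastry, J. Stat. Phys. 53 (1988) 1019–1030,
  eqs. (15)–(21) (the rotation and the Kronecker form, ground-state version).
-/

noncomputable section

open Matrix Finset NormedSpace
open scoped ComplexOrder Kronecker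
open Literature.MathematicalPhysics.QuantumLattice Literature.Probability.LatticeModels

/-! ### Matrix preliminaries: exponential and trace under reindexing; positivity of `Z` -/

namespace Matrix

variable {l m : Type*} [Fintype l] [Fintype m] [DecidableEq l] [DecidableEq m]

/-- The matrix exponential commutes with reindexing along an equivalence. [folklore] -/
theorem exp_submatrix_equiv (M : Matrix m m ℂ) (e : l ≃ m) :
    exp (M.submatrix e e) = (exp M).submatrix e e := by
  letI : NormedRing (Matrix m m ℂ) := Matrix.linftyOpNormedRing
  letI : NormedAlgebra ℂ (Matrix m m ℂ) := Matrix.linftyOpNormedAlgebra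
  letI : NormedAlgebra ℚ (Matrix m m ℂ) := NormedAlgebra.restrictScalars ℚ ℂ (Matrix m m ℂ)
  letI : NormedRing (Matrix l l ℂ) := Matrix.linftyOpNormedRing
  have hf : Continuous (reindexAlgEquiv ℂ ℂ e.symm : Matrix m m ℂ → Matrix l l ℂ) := by
    rw [coe_reindexAlgEquiv]
    exact continuous_id.matrix_submatrix _ _
  have h := map_exp (reindexAlgEquiv ℂ ℂ e.symm) hf M
  simp only [coe_reindexAlgEquiv, reindex_apply, Equiv.symm_symm] at h
  exact h.symm

omit [DecidableEq l] [DecidableEq m] in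
/-- The trace is invariant under reindexing along an equivalence. [folklore] -/
theorem trace_submatrix_equiv (M : Matrix m m ℂ) (e : l ≃ m) :
    (M.submatrix e e).trace = M.trace := by
  simp only [trace, diag_apply, submatrix_apply]
  exact e.sum_comp (fun i => M i i)

/-- The partition function is invariant under reindexing along an equivalence. [folklore] -/
theorem partitionFn_submatrix_equiv (β : ℝ) (M : Matrix m m ℂ) (e : l ≃ m) :
    partitionFn β (M.submatrix e e) = partitionFn β M := by
  rw [partitionFn, partitionFn, gibbsWeight, gibbsWeight,
    show -(β : ℂ) • M.submatrix e e = (-(β : ℂ) • M).submatrix e e from rfl, exp_submatrix_equiv,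
    trace_submatrix_equiv]

/-- The partition function of a Hermitian matrix is a positive real: `Z = (Re Z : ℂ)` with
`Re Z > 0`. [folklore] -/
theorem partitionFn_re_pos [Nonempty m] (β : ℝ) {H : Matrix m m ℂ} (hH : H.IsHermitian) :
    0 < (partitionFn β H).re ∧ partitionFn β H = ((partitionFn β H).re : ℂ) := by
  rw [hH.partitionFn_eq_ofReal β, Complex.ofReal_re]
  exact ⟨hH.sum_exp_pos β, rfl⟩

end Matrix

namespace Literature.MathematicalPhysics.QuantumLattice

variable {d : ℕ}

/-! ### Sites of the two halves -/

section Sites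

variable (L : ℕ) [NeZero L] (j : Fin d) (a : ZMod L)

/-- Splitting a sum over the sites of the even torus into the left half and the reflected left
half. [folklore] -/
theorem sum_sites_split (hL : Even L) {M : Type*} [AddCommMonoid M] (f : TorusSite d L → M) :
    ∑ x, f x = ∑ s ∈ torusLeftHalf L j a, f s +
      ∑ s ∈ torusLeftHalf L j a, f (Torus.reflectBetweenSites j a s) := by
  rw [← Finset.sum_filter_add_sum_filter_not univ (fun x => x ∈ torusLeftHalf L j a)]
  congr 1
  · rw [Finset.filter_univ_mem]
  · symm
    refine Finset.sum_nbij' (Torus.reflectBetweenSites j a) (Torus.reflectBetweenSites j a)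
      (fun x hx => ?_) (fun x hx => ?_) (fun x _ => reflectBetweenSites_reflectBetweenSites L j a x)
      (fun x _ => reflectBetweenSites_reflectBetweenSites L j a x) (fun x _ => rfl)
    · exact mem_filter.2 ⟨mem_univ _, fun h =>
        (reflectBetweenSites_mem_torusLeftHalf_iff L j a hL x).1 h hx⟩
    · obtain ⟨-, hx⟩ := mem_filter.1 hx
      exact (reflectBetweenSites_mem_torusLeftHalf_iff L j a hL x).2 hx

variable {L j a}

/-- **The uniform one-body field is `F ⊗ 1 + 1 ⊗ F`**: for the even torus cut along `θ`,
`Σ_x (c·1 + S^α_x) = ι_L(Σ_{y ∈ left}(c·1 + S^α_y)) + ι_R(Σ_{y ∈ left}(c·1 + S^α_y))`.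
[cite: LSSY2005, Ch. 11 (11.13)] -/
theorem uniformField_eq_embed (hL : Even L) (n : ℕ) (c : ℂ) (α : Fin 3) :
    (∑ x : TorusSite d L, (c • (1 : Op (TorusSite d L) (n + 1)) + siteSpin n x α)) =
      torusLeftEmbed L j a hL (∑ s : torusLeftHalf L j a,
          (c • (1 : Op (torusLeftHalf L j a) (n + 1)) + siteSpin n s α)) +
        torusRightEmbed L j a hL (∑ s : torusLeftHalf L j a,
          (c • (1 : Op (torusLeftHalf L j a) (n + 1)) + siteSpin n s α)) := by
  rw [sum_sites_split L j a hL, ← Finset.sum_coe_sort (torusLeftHalf L j a),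
    ← Finset.sum_coe_sort (torusLeftHalf L j a), map_sum, map_sum]
  congr 1
  · refine sum_congr rfl fun s _ => ?_
    rw [map_add, map_smul, map_one, siteSpin_eq_torusLeftEmbed (hL := hL) n s.2 α,
      torusToLeft_of_mem L j a hL s.2]
  · refine sum_congr rfl fun s _ => ?_
    have hs : Torus.reflectBetweenSites j a s ∉ torusLeftHalf L j a := fun h =>
      (reflectBetweenSites_mem_torusLeftHalf_iff L j a hL (s : TorusSite d L)).1 h s.2
    rw [map_add, map_smul, map_one, siteSpin_eq_torusRightEmbed (hL := hL) n hs α,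
      torusToLeft_reflectBetweenSites, torusToLeft_of_mem L j a hL s.2]

end Sites

/-! ### Reality and Hermiticity of the uniform field -/

section RealField

variable {Λ : Type*} [Fintype Λ] [DecidableEq Λ]

/-- `S³` is a real (diagonal) matrix. [folklore] -/
theorem spinZ_transpose_eq (n : ℕ) :
    (SpinOperators.spinZ n)ᵀ = (SpinOperators.spinZ n)ᴴ := by
  rw [SpinOperators.spinZ, diagonal_transpose, diagonal_conjTranspose]
  congr 1
  funext k
  rw [Pi.star_apply, Complex.star_def, map_sub, map_div₀, map_natCast, map_natCast, map_ofNat]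

/-- `S³_x` is a real matrix. [folklore] -/
theorem siteSpin_two_transpose_eq (n : ℕ) (x : Λ) :
    (siteSpin n x 2 : Op Λ (n + 1))ᵀ = (siteSpin n x 2)ᴴ := by
  rw [siteSpin, spinVec_two]
  exact transpose_eq_conjTranspose_onSite x (spinZ_transpose_eq n)

/-- The uniform field `Σ_x (c·1 + S³_x)` with real `c` is a real matrix. [folklore] -/
theorem uniformField_transpose_eq (n : ℕ) (c : ℝ) :
    (∑ x : Λ, ((c : ℂ) • (1 : Op Λ (n + 1)) + siteSpin n x 2))ᵀ =
      (∑ x : Λ, ((c : ℂ) • (1 : Op Λ (n + 1)) + siteSpin n x 2))ᴴ :=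
  transpose_eq_conjTranspose_sum _ fun x _ => transpose_eq_conjTranspose_add
    (transpose_eq_conjTranspose_ofReal_smul transpose_eq_conjTranspose_one c)
    (siteSpin_two_transpose_eq n x)

/-- The uniform field with real `c` is Hermitian. [folklore] -/
theorem uniformField_isHermitian (n : ℕ) (c : ℝ) :
    (∑ x : Λ, ((c : ℂ) • (1 : Op Λ (n + 1)) + siteSpin n x 2)).IsHermitian := by
  refine (isSelfAdjoint_sum _ fun x _ => ?_).isHermitian
  refine IsHermitian.isSelfAdjoint (IsHermitian.add ?_ (siteSpin_isHermitian n x 2))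
  exact isHermitian_one.smul (isSelfAdjoint_ofReal c)

end RealField

/-! ### The sublattice parity as a sign -/

/-- On the even torus `(ℤ/2kℤ)^d` the staggered sign `(-1)^{Σᵢ xᵢ}` (canonical representatives)
is `+1` on the even sublattice and `-1` on the odd one (parity through `ZMod.castHom`).
[cite: LSSY2005, Ch. 11 (11.2)] -/
theorem neg_one_pow_sum_val_eq (k : ℕ) [NeZero (2 * k)] (x : TorusSite d (2 * k)) :
    ((-1 : ℂ) ^ (∑ i, (x i).val)) =
      if (∑ j, ZMod.castHom (dvd_mul_right 2 k) (ZMod 2) (x j)) = 0 then 1 else -1 := by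
  have hcast : (∑ j, ZMod.castHom (dvd_mul_right 2 k) (ZMod 2) (x j)) =
      ((∑ i, (x i).val : ℕ) : ZMod 2) := by
    rw [Nat.cast_sum]
    refine sum_congr rfl fun j _ => ?_
    rw [ZMod.castHom_apply, ZMod.cast_eq_val]
  rw [hcast]
  by_cases he : Even (∑ i, (x i).val)
  · rw [if_pos (ZMod.natCast_eq_zero_iff_even.2 he), he.neg_one_pow]
  · rw [if_neg (fun h => he (ZMod.natCast_eq_zero_iff_even.1 h)),
      (Nat.not_even_iff_odd.1 he).neg_one_pow]

end Literature.MathematicalPhysics.QuantumLattice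

namespace Literature.Barriers.AtomisticToContinuum.BoseGas

variable {d : ℕ}

/-! ### The sublattice rotation of the field Hamiltonian with the staggered field -/

/-- **The sublattice rotation** ([KLS1988JSP] eqs. (15)–(16); [DLS1978] §2; [LSSY2005] §11.2,
where it appears as the particle–hole transformation inside `θ`): on the even torus of side
`L ≥ 3`, the rotation by `π` about the `1`-axis on the odd sublattice is a unitary `W` mapping
the field Hamiltonian of the hard-core gas `H(h) + λΣ_x(½ + (-1)^xS³_x)` (field `h` on `S¹`) to
`H♭(h) + λΣ_x(½ + S³_x)`: the XY part becomes the real `xyRealFieldHamiltonian` and the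
staggered field becomes uniform. [cite: KLS1988JSP, eqs. (15)–(17)] [cite: LSSY2005, Ch. 11 (11.4)] -/
theorem exists_unitary_conj_hcField (L : ℕ) [NeZero L] (hL : Even L) (hL3 : 3 ≤ L) :
    ∃ W ∈ Matrix.unitaryGroup (TensorIndex (TorusSite d L) 2) ℂ,
      ∀ (lam : ℝ) (h : TorusSite d L → ℝ),
        W * (xyFieldHamiltonian L 1 h + (lam : ℂ) • ∑ x : TorusSite d L,
            ((1 / 2 : ℂ) • (1 : Op (TorusSite d L) 2) + ((-1 : ℂ) ^ (∑ i, (x i).val)) • siteSpin 1 x 2)) *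
          Wᴴ =
        xyRealFieldHamiltonian L 1 h + (lam : ℂ) • ∑ x : TorusSite d L,
            ((1 / 2 : ℂ) • (1 : Op (TorusSite d L) 2) + siteSpin 1 x 2) := by
  obtain ⟨k, rfl⟩ : ∃ k, L = 2 * k := ⟨L / 2, by obtain ⟨k, hk⟩ := hL; omega⟩
  set E := (torusGraph d (2 * k)).edgeFinset with hE
  -- the single-site rotation `R₁ = D² V²` (`π` about the `1`-axis): `Sˣ ↦ Sˣ`, `Sʸ ↦ -Sʸ`, `Sᶻ ↦ -Sᶻ`
  obtain ⟨V, hV, hV', hVz, hVx, hVy⟩ := exists_unitary_conj_spinZ_eq_spinX 1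
  obtain ⟨D, hD, hD', hDx, hDy, hDz⟩ := exists_unitary_conj_spinX_eq_neg_spinY 1
  set R₁ := D * D * (V * V) with hR₁
  have hR₁R₁ : R₁ * R₁ᴴ = 1 := by
    rw [hR₁]
    simp only [conjTranspose_mul, Matrix.mul_assoc]
    rw [← Matrix.mul_assoc V Vᴴ, hV, Matrix.one_mul, ← Matrix.mul_assoc V Vᴴ, hV, Matrix.one_mul,
      ← Matrix.mul_assoc D Dᴴ, hD, Matrix.one_mul, hD]
  have hR₁R₁' : R₁ᴴ * R₁ = 1 := by
    rw [hR₁]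
    simp only [conjTranspose_mul, Matrix.mul_assoc]
    rw [← Matrix.mul_assoc Dᴴ D, hD', Matrix.one_mul, ← Matrix.mul_assoc Dᴴ D, hD', Matrix.one_mul,
      ← Matrix.mul_assoc Vᴴ V, hV', Matrix.one_mul, hV']
  have hconj : ∀ (A B M : Matrix (Fin 2) (Fin 2) ℂ),
      A * B * M * (A * B)ᴴ = A * (B * M * Bᴴ) * Aᴴ := by
    intro A B M
    rw [conjTranspose_mul]
    simp only [Matrix.mul_assoc]
  have hR₁x : R₁ * spinX 1 * R₁ᴴ = spinX 1 := by
    rw [hR₁, hconj, hconj V V, hVx, Matrix.mul_neg, Matrix.neg_mul, hVz, hconj D D, Matrix.mul_neg,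
      Matrix.neg_mul, hDx, neg_neg, hDy]
  have hR₁y : R₁ * spinY 1 * R₁ᴴ = -spinY 1 := by
    rw [hR₁, hconj, hconj V V, hVy, hVy, hconj D D, hDy, hDx]
  have hR₁z : R₁ * SpinOperators.spinZ 1 * R₁ᴴ = -SpinOperators.spinZ 1 := by
    rw [hR₁, hconj, hconj V V, hVz, hVx, hconj D D]
    simp only [Matrix.mul_neg, Matrix.neg_mul, hDz]
  -- the product unitary on the odd sublattice
  set ε : TorusSite d (2 * k) → ZMod 2 := fun x =>
    ∑ j, ZMod.castHom (dvd_mul_right 2 k) (ZMod 2) (x j) with hε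
  set u : TorusSite d (2 * k) → Matrix (Fin 2) (Fin 2) ℂ :=
    fun z => if ε z = 0 then 1 else R₁ with hu
  have hua : ∀ z, u z * (u z)ᴴ = 1 := by
    intro z; simp only [hu]; split_ifs
    · rw [conjTranspose_one, Matrix.mul_one]
    · exact hR₁R₁
  have hua' : ∀ z, (u z)ᴴ * u z = 1 := by
    intro z; simp only [hu]; split_ifs
    · rw [conjTranspose_one, Matrix.mul_one]
    · exact hR₁R₁'
  set sgn : TorusSite d (2 * k) → ℂ := fun z => if ε z = 0 then 1 else -1 with hsgn
  have hux : ∀ z, u z * spinX 1 * (u z)ᴴ = spinX 1 := by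
    intro z; simp only [hu]; split_ifs
    · rw [conjTranspose_one, Matrix.mul_one, Matrix.one_mul]
    · exact hR₁x
  have huy : ∀ z, u z * spinY 1 * (u z)ᴴ = sgn z • spinY 1 := by
    intro z; simp only [hu, hsgn]; split_ifs
    · rw [conjTranspose_one, Matrix.mul_one, Matrix.one_mul, one_smul]
    · rw [hR₁y, neg_one_smul]
  have huz : ∀ z, u z * SpinOperators.spinZ 1 * (u z)ᴴ = sgn z • SpinOperators.spinZ 1 := by
    intro z; simp only [hu, hsgn]; split_ifs
    · rw [conjTranspose_one, Matrix.mul_one, Matrix.one_mul, one_smul]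
    · rw [hR₁z, neg_one_smul]
  have hedge : ∀ e ∈ E, ∀ x y, e = s(x, y) → sgn x * sgn y = -1 := by
    intro e he x y hexy
    subst hexy
    rw [hE, SimpleGraph.mem_edgeFinset, SimpleGraph.mem_edgeSet, torusGraph_adj_iff] at he
    have h01 : ∀ t : ZMod 2, t = 0 ∨ t = 1 := by decide
    have key : ∀ x' : TorusSite d (2 * k), ∀ i, sgn x' * sgn (x' + Pi.single i 1) = -1 := by
      intro x' i
      have hpar : ε (x' + Pi.single i 1) = ε x' + 1 := torusParity_add_single k x' i
      simp only [hsgn, hpar]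
      rcases h01 (ε x') with h0 | h1
      · rw [if_pos h0, if_neg (by rw [h0]; decide), one_mul]
      · rw [if_neg (by rw [h1]; decide), if_pos (by rw [h1]; decide), mul_one]
    obtain ⟨-, ⟨i, rfl⟩ | ⟨i, rfl⟩⟩ := he
    · exact key x i
    · rw [mul_comm]; exact key y i
  set W := productOp u with hW
  have hWx : ∀ x : TorusSite d (2 * k), W * siteSpin 1 x 0 * Wᴴ = siteSpin 1 x 0 := by
    intro x
    rw [hW, productOp_conj_siteSpin hua, spinVec_zero, hux]
    rfl
  have hWz : ∀ x : TorusSite d (2 * k), W * siteSpin 1 x 2 * Wᴴ = sgn x • siteSpin 1 x 2 := by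
    intro x
    rw [hW, productOp_conj_siteSpin hua, spinVec_two, huz, onSite_smul']
    rfl
  have hb0 : ∀ x y : TorusSite d (2 * k), W * spinBond 1 0 x y * Wᴴ = spinBond 1 0 x y := by
    intro x y
    rw [hW, productOp_conj_spinBond hua hua', spinVec_zero, hux, hux, spinBond]
    rfl
  have hb1 : ∀ x y : TorusSite d (2 * k), sgn x * sgn y = -1 →
      W * spinBond 1 1 x y * Wᴴ = -spinBond 1 1 x y := by
    intro x y hxy
    rw [hW, productOp_conj_spinBond hua hua', spinVec_one, huy, huy, onSite_smul', onSite_smul',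
      smul_mul_smul_comm, smul_mul_smul_comm, mul_comm (sgn y) (sgn x), hxy, spinBond]
    simp only [neg_smul, one_smul]
    rw [← neg_add, smul_neg]
    rfl
  have hW1 : W * (1 : Op (TorusSite d (2 * k)) 2) * Wᴴ = 1 := by
    rw [Matrix.mul_one, hW, productOp_mul_conjTranspose hua]
  -- the staggered sign is the sublattice sign
  have hstag : ∀ x : TorusSite d (2 * k), ((-1 : ℂ) ^ (∑ i, (x i).val)) = sgn x :=
    fun x => neg_one_pow_sum_val_eq k x
  have hsgn2 : ∀ x, sgn x * sgn x = 1 := by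
    intro x; simp only [hsgn]; split_ifs <;> norm_num
  refine ⟨W, Matrix.mem_unitaryGroup_iff.2 (by rw [hW]; exact productOp_mul_conjTranspose hua),
    fun lam h => ?_⟩
  -- conjugate the edge sum
  have hHW : W * xyFieldHamiltonian (2 * k) 1 h * Wᴴ = xyRealFieldHamiltonian (2 * k) 1 h := by
    rw [xyFieldHamiltonian_eq_edgeSum (2 * k) hL3, xyRealFieldHamiltonian, ← hE, Finset.mul_sum,
      Finset.sum_mul]
    refine sum_congr rfl fun e he => ?_
    induction e using Sym2.ind with
    | h x y =>
      have hs := hedge _ he x y rfl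
      simp only [Sym2.lift_mk, xyRealBond, Matrix.mul_add, Matrix.add_mul, Matrix.mul_sub,
        Matrix.sub_mul, Matrix.mul_neg, Matrix.neg_mul, Matrix.mul_smul, Matrix.smul_mul, hb0,
        hb1 x y hs, hW1, hWx]
      abel
  -- conjugate the staggered field
  have hFW : W * (∑ x : TorusSite d (2 * k), ((1 / 2 : ℂ) • (1 : Op (TorusSite d (2 * k)) 2) +
      ((-1 : ℂ) ^ (∑ i, (x i).val)) • siteSpin 1 x 2)) * Wᴴ =
      ∑ x : TorusSite d (2 * k), ((1 / 2 : ℂ) • (1 : Op (TorusSite d (2 * k)) 2) + siteSpin 1 x 2) := by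
    rw [Finset.mul_sum, Finset.sum_mul]
    refine sum_congr rfl fun x _ => ?_
    rw [Matrix.mul_add, Matrix.add_mul, Matrix.mul_smul, Matrix.smul_mul, hW1, Matrix.mul_smul,
      Matrix.smul_mul, hWz, smul_smul, hstag, hsgn2, one_smul]
  rw [Matrix.mul_add, Matrix.add_mul, hHW, Matrix.mul_smul, Matrix.smul_mul, hFW]


/-! ### Kronecker bookkeeping -/

section KroneckerAlgebra

variable {p : Type*} [Fintype p] [DecidableEq p] {ι : Type*} [Fintype ι]

omit [Fintype p] [Fintype ι] in
/-- Adding a one-body term `c(F ⊗ 1 + 1 ⊗ F)` to a Kronecker form. [folklore] -/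
theorem kroneckerForm_add_smul_field (A B F : Matrix p p ℂ) (S : Matrix (p × p) (p × p) ℂ)
    (c : ℂ) :
    A ⊗ₖ (1 : Matrix p p ℂ) + (1 : Matrix p p ℂ) ⊗ₖ B - S +
        c • (F ⊗ₖ (1 : Matrix p p ℂ) + (1 : Matrix p p ℂ) ⊗ₖ F) =
      (A + c • F) ⊗ₖ (1 : Matrix p p ℂ) + (1 : Matrix p p ℂ) ⊗ₖ (B + c • F) - S := by
  rw [add_kronecker, kronecker_add, smul_kronecker, kronecker_smul, smul_add]
  abel

omit [Fintype p] in
/-- `-β(A ⊗ 1 + 1 ⊗ B - Σᵢ Mᵢ ⊗ Nᵢ) = (-βA) ⊗ 1 + 1 ⊗ (-βB) + Σᵢ (√βMᵢ) ⊗ (√βNᵢ)` for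
`β ≥ 0`: the form to which the Dyson–Lieb–Simon inequality applies. [cite: DLS1978, Lemma 4.1] -/
theorem neg_smul_kroneckerForm {β : ℝ} (hβ : 0 ≤ β) (A B : Matrix p p ℂ)
    (M N : ι → Matrix p p ℂ) :
    -(β : ℂ) • (A ⊗ₖ (1 : Matrix p p ℂ) + (1 : Matrix p p ℂ) ⊗ₖ B - ∑ i, M i ⊗ₖ N i) =
      (-(β : ℂ) • A) ⊗ₖ (1 : Matrix p p ℂ) + (1 : Matrix p p ℂ) ⊗ₖ (-(β : ℂ) • B) +
        ∑ i, ((Real.sqrt β : ℂ) • M i) ⊗ₖ ((Real.sqrt β : ℂ) • N i) := by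
  have hsq : (Real.sqrt β : ℂ) * Real.sqrt β = β := by
    rw [← Complex.ofReal_mul, Real.mul_self_sqrt hβ]
  simp only [smul_sub, smul_add, smul_kronecker, kronecker_smul, Finset.smul_sum, smul_smul, hsq]
  rw [sub_eq_add_neg, ← Finset.sum_neg_distrib]
  congr 1
  refine sum_congr rfl fun i _ => ?_
  rw [neg_smul, neg_neg]

end KroneckerAlgebra

/-! ### The reflection inequality `Z(h)² ≤ Z(h^L) Z(h^R)` -/

section Reflection

variable (L : ℕ) [NeZero L] (j : Fin d) (a : ZMod L)

/-- `H(h) = H - V_h + ½Q(h)` (the XY part) is Hermitian. [folklore] -/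
theorem xyFieldHamiltonian_isHermitian (n : ℕ) (h : TorusSite d L → ℝ) :
    (xyFieldHamiltonian L n h).IsHermitian := by
  rw [xyFieldHamiltonian]
  exact ((xyTorus_isHermitian d L n).sub (xyGradField_isHermitian L n h)).add
    (isHermitian_one.smul (isSelfAdjoint_ofReal _))

/-- The field Hamiltonian of the hard-core gas, `H(h) + λΣ_x(½ + (-1)^xS³_x)`, is Hermitian.
[cite: LSSY2005, Ch. 11 (11.2), (11.11)] -/
theorem hcField_isHermitian (lam : ℝ) (h : TorusSite d L → ℝ) :
    (xyFieldHamiltonian L 1 h + (lam : ℂ) • ∑ x : TorusSite d L,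
      ((1 / 2 : ℂ) • (1 : Op (TorusSite d L) 2) + ((-1 : ℂ) ^ (∑ i, (x i).val)) • siteSpin 1 x 2)).IsHermitian :=
  (xyFieldHamiltonian_isHermitian L 1 h).add
    ((staggeredField_isHermitian d L).smul (isSelfAdjoint_ofReal lam))

/-- **The reflection inequality for the partition function** ([LSSY2005] (11.19); [DLS1978]
Lemma 4.1 applied as in the proof of Thm. 4.2): on the even torus of side `L ≥ 4`, for every pair
of planes, every `β > 0`, every `λ` and every real field `h` on `S¹`,
`Z(h)² ≤ Z(h^L) Z(h^R)` for `Z(f) = Tr exp(-β[H(f) + λΣ_x(½ + (-1)^xS³_x)])`. After the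
sublattice rotation the three Hamiltonians are the Kronecker forms
`(A+λF)⊗1 + 1⊗(B+λF) - ΣMᵢ⊗Nᵢ`, `(A+λF)⊗1 + 1⊗(A+λF) - ΣMᵢ⊗Mᵢ`, `(B+λF)⊗1 + 1⊗(B+λF) - ΣNᵢ⊗Nᵢ`
with real `A, B, F, Mᵢ, Nᵢ`, and `Matrix.trace_exp_kroneckerSum_le` applies.
[cite: LSSY2005, Ch. 11 (11.13)–(11.19)] [cite: DLS1978, Lemma 4.1, Thm. 4.2] -/
theorem partitionFn_hcField_sq_le (hL : Even L) (hL3 : 3 ≤ L) {β : ℝ} (hβ : 0 < β) (lam : ℝ)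
    (h : TorusSite d L → ℝ) :
    (partitionFn β (xyFieldHamiltonian L 1 h + (lam : ℂ) • ∑ x : TorusSite d L,
        ((1 / 2 : ℂ) • (1 : Op (TorusSite d L) 2) + ((-1 : ℂ) ^ (∑ i, (x i).val)) • siteSpin 1 x 2))).re ^ 2 ≤
      (partitionFn β (xyFieldHamiltonian L 1 (reflectFieldLeft L j a h) + (lam : ℂ) •
        ∑ x : TorusSite d L, ((1 / 2 : ℂ) • (1 : Op (TorusSite d L) 2) +
          ((-1 : ℂ) ^ (∑ i, (x i).val)) • siteSpin 1 x 2))).re *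
      (partitionFn β (xyFieldHamiltonian L 1 (reflectFieldRight L j a h) + (lam : ℂ) •
        ∑ x : TorusSite d L, ((1 / 2 : ℂ) • (1 : Op (TorusSite d L) 2) +
          ((-1 : ℂ) ^ (∑ i, (x i).val)) • siteSpin 1 x 2))).re := by
  -- positivity of the three partition functions
  have hZpos : ∀ f : TorusSite d L → ℝ,
      0 < (partitionFn β (xyFieldHamiltonian L 1 f + (lam : ℂ) • ∑ x : TorusSite d L,
        ((1 / 2 : ℂ) • (1 : Op (TorusSite d L) 2) + ((-1 : ℂ) ^ (∑ i, (x i).val)) • siteSpin 1 x 2))).re :=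
    fun f => (partitionFn_re_pos β (hcField_isHermitian L lam f)).1
  have hx0 := hZpos h
  have hy0 := hZpos (reflectFieldLeft L j a h)
  have hz0 := hZpos (reflectFieldRight L j a h)
  -- the rotation
  obtain ⟨W, hWu, hW⟩ := exists_unitary_conj_hcField (d := d) L hL hL3
  have hWu' : W ∈ unitary (Matrix (TensorIndex (TorusSite d L) 2) (TensorIndex (TorusSite d L) 2) ℂ) :=
    hWu
  have hrot : ∀ f : TorusSite d L → ℝ,
      partitionFn β (xyFieldHamiltonian L 1 f + (lam : ℂ) • ∑ x : TorusSite d L,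
        ((1 / 2 : ℂ) • (1 : Op (TorusSite d L) 2) + ((-1 : ℂ) ^ (∑ i, (x i).val)) • siteSpin 1 x 2)) =
      partitionFn β (xyRealFieldHamiltonian L 1 f + (lam : ℂ) • ∑ x : TorusSite d L,
        ((1 / 2 : ℂ) • (1 : Op (TorusSite d L) 2) + siteSpin 1 x 2)) := by
    intro f
    rw [← hW lam f, ← star_eq_conjTranspose, partitionFn_unitary_conj hWu']
  -- abbreviations
  set A := xyLeftHamiltonian L j a hL 1 h with hA
  set B := xyLeftHamiltonian L j a hL 1 (fun y => h (Torus.reflectBetweenSites j a y)) with hB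
  set M := xyCrossOp L j a hL 1 h with hM
  set N := xyCrossOp L j a hL 1 (fun y => h (Torus.reflectBetweenSites j a y)) with hN
  set e := torusSplit (q := 2) L j a hL with he
  set F : Op (torusLeftHalf L j a) 2 :=
    ∑ s : torusLeftHalf L j a, ((((1 / 2 : ℝ)) : ℂ) • (1 : Op (torusLeftHalf L j a) 2) + siteSpin 1 s 2)
    with hF
  -- the uniform field in Kronecker form
  have h12 : ((1 / 2 : ℝ) : ℂ) = 1 / 2 := by push_cast; ring
  have hU : (∑ x : TorusSite d L, ((1 / 2 : ℂ) • (1 : Op (TorusSite d L) 2) + siteSpin 1 x 2)) =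
      (F ⊗ₖ (1 : Op (torusLeftHalf L j a) 2) + (1 : Op (torusLeftHalf L j a) 2) ⊗ₖ F).submatrix e e := by
    have hu := uniformField_eq_embed (j := j) (a := a) hL 1 (((1 / 2 : ℝ)) : ℂ) 2 (d := d) (L := L)
    rw [h12] at hu
    rw [hu, hF, h12, torusLeftEmbed_apply, torusRightEmbed_apply, submatrix_add]
    rfl
  -- the three Kronecker forms (XY part), as in `groundEnergy_reflect_le`
  have hK : xyRealFieldHamiltonian L 1 h =
      (A ⊗ₖ 1 + 1 ⊗ₖ B - ∑ i, M i ⊗ₖ N i).submatrix e e :=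
    xyRealFieldHamiltonian_eq_submatrix L j a hL 1 h
  have hKL : xyRealFieldHamiltonian L 1 (reflectFieldLeft L j a h) =
      (A ⊗ₖ 1 + 1 ⊗ₖ A - ∑ i, M i ⊗ₖ M i).submatrix e e := by
    rw [xyRealFieldHamiltonian_eq_submatrix L j a hL 1,
      xyLeftHamiltonian_congr L j a 1 hL (fun x hx => reflectFieldLeft_of_mem L j a h hx),
      xyLeftHamiltonian_congr L j a 1 hL
        (fun x hx => reflectFieldLeft_reflectBetweenSites_of_mem L j a hL h hx),
      xyCrossOp_congr L j a 1 hL (fun x hx => reflectFieldLeft_of_mem L j a h hx),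
      xyCrossOp_congr L j a 1 hL (fun x hx => reflectFieldLeft_reflectBetweenSites_of_mem L j a hL h hx)]
  have hKR : xyRealFieldHamiltonian L 1 (reflectFieldRight L j a h) =
      (B ⊗ₖ 1 + 1 ⊗ₖ B - ∑ i, N i ⊗ₖ N i).submatrix e e := by
    rw [xyRealFieldHamiltonian_eq_submatrix L j a hL 1,
      xyLeftHamiltonian_congr L j a 1 hL (fun x hx => reflectFieldRight_of_mem L j a h hx),
      xyLeftHamiltonian_congr L j a 1 hL
        (h₁ := fun y => reflectFieldRight L j a h (Torus.reflectBetweenSites j a y))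
        (fun x hx => reflectFieldRight_reflectBetweenSites_of_mem L j a hL h hx),
      xyCrossOp_congr L j a 1 hL (fun x hx => reflectFieldRight_of_mem L j a h hx),
      xyCrossOp_congr L j a 1 hL (h₁ := fun y => reflectFieldRight L j a h (Torus.reflectBetweenSites j a y))
        (fun x hx => reflectFieldRight_reflectBetweenSites_of_mem L j a hL h hx)]
  -- adding the field: the full Kronecker forms
  have hfull : ∀ (X Y : Op (torusLeftHalf L j a) 2) (S : Matrix _ _ ℂ),
      (X ⊗ₖ (1 : Op (torusLeftHalf L j a) 2) + (1 : Op (torusLeftHalf L j a) 2) ⊗ₖ Y - S).submatrix e e +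
        (lam : ℂ) • (F ⊗ₖ (1 : Op (torusLeftHalf L j a) 2) +
          (1 : Op (torusLeftHalf L j a) 2) ⊗ₖ F).submatrix e e =
      ((X + ((lam : ℂ) • F)) ⊗ₖ (1 : Op (torusLeftHalf L j a) 2) + (1 : Op (torusLeftHalf L j a) 2) ⊗ₖ (Y + ((lam : ℂ) • F)) -
        S).submatrix e e := by
    intro X Y S
    rw [← kroneckerForm_add_smul_field]
    rfl
  -- partition functions as traces of exponentials of the DLS forms
  have hZ : ∀ (X Y : Op (torusLeftHalf L j a) 2) (P Q : torusCrossSites L j a × Bool → Op (torusLeftHalf L j a) 2),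
      partitionFn β (((X + ((lam : ℂ) • F)) ⊗ₖ (1 : Op (torusLeftHalf L j a) 2) +
        (1 : Op (torusLeftHalf L j a) 2) ⊗ₖ (Y + ((lam : ℂ) • F)) - ∑ i, P i ⊗ₖ Q i).submatrix e e) =
      (exp ((-(β : ℂ) • (X + ((lam : ℂ) • F))) ⊗ₖ (1 : Op (torusLeftHalf L j a) 2) +
        (1 : Op (torusLeftHalf L j a) 2) ⊗ₖ (-(β : ℂ) • (Y + ((lam : ℂ) • F))) +
        ∑ i, ((Real.sqrt β : ℂ) • P i) ⊗ₖ ((Real.sqrt β : ℂ) • Q i))).trace := by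
    intro X Y P Q
    rw [partitionFn_submatrix_equiv, partitionFn, gibbsWeight, neg_smul_kroneckerForm hβ.le]
  -- reality
  have hFt : Fᵀ = Fᴴ := by rw [hF]; exact uniformField_transpose_eq 1 (1 / 2)
  have hFlt : ((lam : ℂ) • F)ᵀ = ((lam : ℂ) • F)ᴴ := transpose_eq_conjTranspose_ofReal_smul hFt lam
  have hnegβ : ∀ {X : Op (torusLeftHalf L j a) 2}, Xᵀ = Xᴴ → (-(β : ℂ) • X)ᵀ = (-(β : ℂ) • X)ᴴ := by
    intro X hX
    have h := transpose_eq_conjTranspose_ofReal_smul hX (-β)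
    rwa [Complex.ofReal_neg] at h
  have hAt : (-(β : ℂ) • (A + ((lam : ℂ) • F)))ᵀ = (-(β : ℂ) • (A + ((lam : ℂ) • F)))ᴴ :=
    hnegβ (transpose_eq_conjTranspose_add (xyLeftHamiltonian_transpose_eq L j a 1 hL h) hFlt)
  have hBt : (-(β : ℂ) • (B + ((lam : ℂ) • F)))ᵀ = (-(β : ℂ) • (B + ((lam : ℂ) • F)))ᴴ :=
    hnegβ (transpose_eq_conjTranspose_add (xyLeftHamiltonian_transpose_eq L j a 1 hL _) hFlt)
  have hMt : ∀ i, ((Real.sqrt β : ℂ) • M i)ᵀ = ((Real.sqrt β : ℂ) • M i)ᴴ := fun i =>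
    transpose_eq_conjTranspose_ofReal_smul (xyCrossOp_transpose_eq L j a 1 hL h i) _
  have hNt : ∀ i, ((Real.sqrt β : ℂ) • N i)ᵀ = ((Real.sqrt β : ℂ) • N i)ᴴ := fun i =>
    transpose_eq_conjTranspose_ofReal_smul (xyCrossOp_transpose_eq L j a 1 hL _ i) _
  haveI : Nonempty (torusLeftHalf L j a → Fin (1 + 1)) := ⟨fun _ => 0⟩
  have hDLS := Matrix.trace_exp_kroneckerSum_le (m := torusLeftHalf L j a → Fin (1 + 1))
    (n := torusLeftHalf L j a → Fin (1 + 1)) hAt hBt hMt hNt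
  -- the inequality `Z(h) ≤ Z(h^L)^{1/2} Z(h^R)^{1/2}`
  have hineq : (partitionFn β (xyFieldHamiltonian L 1 h + (lam : ℂ) • ∑ x : TorusSite d L,
        ((1 / 2 : ℂ) • (1 : Op (TorusSite d L) 2) + ((-1 : ℂ) ^ (∑ i, (x i).val)) • siteSpin 1 x 2))).re ≤
      Real.sqrt (partitionFn β (xyFieldHamiltonian L 1 (reflectFieldLeft L j a h) + (lam : ℂ) •
        ∑ x : TorusSite d L, ((1 / 2 : ℂ) • (1 : Op (TorusSite d L) 2) +
          ((-1 : ℂ) ^ (∑ i, (x i).val)) • siteSpin 1 x 2))).re *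
      Real.sqrt (partitionFn β (xyFieldHamiltonian L 1 (reflectFieldRight L j a h) + (lam : ℂ) •
        ∑ x : TorusSite d L, ((1 / 2 : ℂ) • (1 : Op (TorusSite d L) 2) +
          ((-1 : ℂ) ^ (∑ i, (x i).val)) • siteSpin 1 x 2))).re := by
    rw [hrot, hrot, hrot, hU, hK, hKL, hKR, hfull, hfull, hfull, hZ, hZ, hZ]
    exact hDLS
  calc _ ≤ (Real.sqrt (partitionFn β (xyFieldHamiltonian L 1 (reflectFieldLeft L j a h) + (lam : ℂ) •
        ∑ x : TorusSite d L, ((1 / 2 : ℂ) • (1 : Op (TorusSite d L) 2) +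
          ((-1 : ℂ) ^ (∑ i, (x i).val)) • siteSpin 1 x 2))).re *
      Real.sqrt (partitionFn β (xyFieldHamiltonian L 1 (reflectFieldRight L j a h) + (lam : ℂ) •
        ∑ x : TorusSite d L, ((1 / 2 : ℂ) • (1 : Op (TorusSite d L) 2) +
          ((-1 : ℂ) ^ (∑ i, (x i).val)) • siteSpin 1 x 2))).re) ^ 2 :=
        pow_le_pow_left₀ hx0.le hineq 2
    _ = _ := by rw [mul_pow, Real.sq_sqrt hy0.le, Real.sq_sqrt hz0.le]

end Reflection

/-! ### The descent: Gaussian domination -/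

section Descent

variable (L : ℕ) [NeZero L]

/-- The field Hamiltonian of the hard-core gas: `H - V_h + ½Q(h) = H(h) + λΣ_x(½ + (-1)^xS³_x)`
(`H = hardCoreLatticeGas`, `H(h) = xyFieldHamiltonian`). [cite: LSSY2005, Ch. 11 (11.2), (11.11)] -/
theorem hardCoreLatticeGas_sub_add_eq (lam : ℝ) (h : TorusSite d L → ℝ) :
    hardCoreLatticeGas d L lam - xyGradField L 1 h +
        ((xyFieldEnergy L h / 2 : ℝ) : ℂ) • (1 : Op (TorusSite d L) 2) =
      xyFieldHamiltonian L 1 h + (lam : ℂ) • ∑ x : TorusSite d L,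
        ((1 / 2 : ℂ) • (1 : Op (TorusSite d L) 2) + ((-1 : ℂ) ^ (∑ i, (x i).val)) • siteSpin 1 x 2) := by
  rw [hardCoreLatticeGas_eq, xyFieldHamiltonian]
  abel

/-- **Gaussian domination at positive temperature for the hard-core lattice gas**
([LSSY2005] Ch. 11 (11.12): `Z(h) ≤ Z(0)`; [DLS1978] Thm. 4.2): on the even torus of side
`L ≥ 4`, for every `β > 0`, every `λ` and every real field `h`,
`Z_β(H - V_h + ½Q(h)) ≤ Z_β(H)`, `H = hardCoreLatticeGas d L λ`, `V_h = Σ(h_x - h_y)(S¹_x - S¹_y)`,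
`Q(h) = Σ(h_x - h_y)²`. Proof: the descent of [LSSY2005] after (11.20) ([DLS1978] proof of
Thm. 4.2; [KLS1988JSP] pp. 1027–1029): among the finitely many fields with values in the range of
`h` take a maximiser of `Z` with the fewest bonds `{x,y}` with `f_x ≠ f_y`; a bad bond and the
planes through it give `Z(f)² ≤ Z(f^L)Z(f^R)` (`partitionFn_hcField_sq_le`), so `f^L`, `f^R` are
maximisers and one has fewer bad bonds (`badBondCount_reflect`) — contradiction; so the maximiser
is constant on bonds and its Hamiltonian is `H` itself.
[cite: LSSY2005, Ch. 11 (11.12), (11.19)–(11.20)] [cite: DLS1978, Thm. 4.2] -/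
theorem hc_partitionFn_field_le (hL : Even L) (h4 : 4 ≤ L) {β : ℝ} (hβ : 0 < β) (lam : ℝ)
    (g : TorusSite d L → ℝ) :
    (partitionFn β (hardCoreLatticeGas d L lam - xyGradField L 1 g +
        ((xyFieldEnergy L g / 2 : ℝ) : ℂ) • (1 : Op (TorusSite d L) 2))).re ≤
      (partitionFn β (hardCoreLatticeGas d L lam)).re := by
  classical
  have hL3 : 3 ≤ L := by omega
  have hL2 : 2 ≤ L := by omega
  rw [hardCoreLatticeGas_sub_add_eq]
  -- the finite search space
  set V : Finset ℝ := (univ : Finset (TorusSite d L)).image g with hV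
  set Zf : (TorusSite d L → V) → ℝ := fun f =>
    (partitionFn β (xyFieldHamiltonian L 1 (fun x => (f x : ℝ)) + (lam : ℂ) •
      ∑ x : TorusSite d L, ((1 / 2 : ℂ) • (1 : Op (TorusSite d L) 2) +
        ((-1 : ℂ) ^ (∑ i, (x i).val)) • siteSpin 1 x 2))).re with hZf
  set Nf : (TorusSite d L → V) → ℕ := fun f => badBondCount L (fun x => (f x : ℝ)) with hNf
  set g' : TorusSite d L → V := fun x => ⟨g x, mem_image_of_mem g (mem_univ x)⟩ with hg'
  haveI : Nonempty (TorusSite d L → V) := ⟨g'⟩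
  obtain ⟨f₀, hf₀⟩ := Finite.exists_max Zf
  set S : Finset (TorusSite d L → V) := univ.filter fun f => Zf f = Zf f₀ with hS
  obtain ⟨f₁, hf₁S, hf₁min⟩ := S.exists_min_image Nf ⟨f₀, by simp [hS]⟩
  have hZf₁ : Zf f₁ = Zf f₀ := (mem_filter.1 hf₁S).2
  -- positivity of `Z`
  have hZpos : ∀ f : TorusSite d L → ℝ,
      0 < (partitionFn β (xyFieldHamiltonian L 1 f + (lam : ℂ) • ∑ x : TorusSite d L,
        ((1 / 2 : ℂ) • (1 : Op (TorusSite d L) 2) + ((-1 : ℂ) ^ (∑ i, (x i).val)) • siteSpin 1 x 2))).re :=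
    fun f => (partitionFn_re_pos β (hcField_isHermitian L lam f)).1
  -- the maximiser has no bad bonds
  have hN0 : Nf f₁ = 0 := by
    by_contra hN
    -- a bad pair `(x₀, i)`
    obtain ⟨x₀, i, hbad⟩ : ∃ (x₀ : TorusSite d L) (i : Fin d),
        (f₁ x₀ : ℝ) ≠ f₁ (x₀ + Pi.single i 1) := by
      obtain ⟨e, he⟩ := Finset.card_ne_zero.1 hN
      obtain ⟨heE, hbe⟩ := mem_filter.1 he
      revert heE hbe
      refine Sym2.ind (fun u v => ?_) e
      intro heE hbe
      rw [SimpleGraph.mem_edgeFinset, SimpleGraph.mem_edgeSet, torusGraph_adj_iff] at heE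
      rw [Sym2.map_mk, Sym2.mk_isDiag_iff] at hbe
      obtain ⟨-, ⟨i, rfl⟩ | ⟨i, rfl⟩⟩ := heE
      · exact ⟨u, i, hbe⟩
      · exact ⟨v, i, fun h' => hbe h'.symm⟩
    -- the planes through it
    set j := i
    obtain ⟨hxCS, hθx⟩ := add_single_mem_torusCrossSites L hL2 j x₀
    set a : ZMod L := x₀ j with ha
    -- the reflected fields, inside the search space
    set φ : TorusSite d L → ℝ := fun x => (f₁ x : ℝ) with hφ
    set fL : TorusSite d L → V := fun y =>
      if y ∈ torusLeftHalf L j a then f₁ y else f₁ (Torus.reflectBetweenSites j a y) with hfL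
    set fR : TorusSite d L → V := fun y =>
      if y ∈ torusLeftHalf L j a then f₁ (Torus.reflectBetweenSites j a y) else f₁ y with hfR
    have hfLφ : (fun x => (fL x : ℝ)) = reflectFieldLeft L j a φ := by
      funext y
      simp only [hfL, reflectFieldLeft, hφ]
      split_ifs <;> rfl
    have hfRφ : (fun x => (fR x : ℝ)) = reflectFieldRight L j a φ := by
      funext y
      simp only [hfR, reflectFieldRight, hφ]
      split_ifs <;> rfl
    -- `Z(f₁)² ≤ Z(f^L) Z(f^R)`, and all three are at most the maximum `Z(f₁)`
    have hRP := partitionFn_hcField_sq_le L j a hL hL3 hβ lam φ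
    have hEL : Zf fL = (partitionFn β (xyFieldHamiltonian L 1 (reflectFieldLeft L j a φ) +
        (lam : ℂ) • ∑ x : TorusSite d L, ((1 / 2 : ℂ) • (1 : Op (TorusSite d L) 2) +
          ((-1 : ℂ) ^ (∑ i, (x i).val)) • siteSpin 1 x 2))).re := by
      simp only [hZf, hfLφ]
    have hER : Zf fR = (partitionFn β (xyFieldHamiltonian L 1 (reflectFieldRight L j a φ) +
        (lam : ℂ) • ∑ x : TorusSite d L, ((1 / 2 : ℂ) • (1 : Op (TorusSite d L) 2) +
          ((-1 : ℂ) ^ (∑ i, (x i).val)) • siteSpin 1 x 2))).re := by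
      simp only [hZf, hfRφ]
    have hE1 : Zf f₁ = (partitionFn β (xyFieldHamiltonian L 1 φ +
        (lam : ℂ) • ∑ x : TorusSite d L, ((1 / 2 : ℂ) • (1 : Op (TorusSite d L) 2) +
          ((-1 : ℂ) ^ (∑ i, (x i).val)) • siteSpin 1 x 2))).re := by simp only [hZf, hφ]
    rw [← hEL, ← hER, ← hE1] at hRP
    have h1 := hf₀ fL
    have h2 := hf₀ fR
    have hL0 : 0 < Zf fL := by rw [hEL]; exact hZpos _
    have hR0 : 0 < Zf fR := by rw [hER]; exact hZpos _
    -- both reflected fields are maximisers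
    have hELm : Zf fL = Zf f₀ := by
      by_contra hne
      have hlt : Zf fL < Zf f₀ := lt_of_le_of_ne h1 hne
      have : Zf fL * Zf fR < Zf f₀ * Zf f₀ := mul_lt_mul hlt h2 hR0 (hlt.le.trans' hL0.le)
      rw [hZf₁] at hRP
      nlinarith
    have hERm : Zf fR = Zf f₀ := by
      by_contra hne
      have hlt : Zf fR < Zf f₀ := lt_of_le_of_ne h2 hne
      have : Zf fL * Zf fR < Zf f₀ * Zf f₀ := mul_lt_mul' h1 hlt hR0.le (hL0.trans_le h1)
      rw [hZf₁] at hRP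
      nlinarith
    have hNL : Nf f₁ ≤ Nf fL := hf₁min fL (by simp [hS, hELm])
    have hNR : Nf f₁ ≤ Nf fR := hf₁min fR (by simp [hS, hERm])
    -- counting: `N(f^L) + N(f^R) + 2N_C = 2N(f)` with `N_C ≥ 1`
    have hcount := badBondCount_reflect L j a hL φ
    have hNLφ : Nf fL = badBondCount L (reflectFieldLeft L j a φ) := by simp only [hNf, hfLφ]
    have hNRφ : Nf fR = badBondCount L (reflectFieldRight L j a φ) := by simp only [hNf, hfRφ]
    have hN1φ : Nf f₁ = badBondCount L φ := by simp only [hNf, hφ]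
    have hC : 1 ≤ ∑ x ∈ torusCrossSites L j a,
        (if (Sym2.map φ s(x, Torus.reflectBetweenSites j a x)).IsDiag then 0 else 1) := by
      have hone : (if (Sym2.map φ s(x₀ + Pi.single j 1,
          Torus.reflectBetweenSites j a (x₀ + Pi.single j 1))).IsDiag then 0 else 1) = 1 := by
        simp only [hθx, Sym2.map_mk, Sym2.mk_isDiag_iff]
        rw [if_neg]
        exact fun h' => hbad h'.symm
      calc 1 = (if (Sym2.map φ s(x₀ + Pi.single j 1,
          Torus.reflectBetweenSites j a (x₀ + Pi.single j 1))).IsDiag then 0 else 1) := hone.symm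
        _ ≤ _ := Finset.single_le_sum (f := fun x =>
          if (Sym2.map φ s(x, Torus.reflectBetweenSites j a x)).IsDiag then 0 else 1)
          (fun _ _ => Nat.zero_le _) hxCS
    rw [← hNLφ, ← hNRφ, ← hN1φ] at hcount
    omega
  -- hence `H(f₁) = H` and `Z(g) ≤ Z(f₁) = Z(H)`
  have hH : xyFieldHamiltonian L 1 (fun x => (f₁ x : ℝ)) = xyTorus d L 1 :=
    xyFieldHamiltonian_eq_of_badBondCount_eq_zero L hL2 1 hN0
  have hEg : Zf g' = (partitionFn β (xyFieldHamiltonian L 1 g + (lam : ℂ) •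
      ∑ x : TorusSite d L, ((1 / 2 : ℂ) • (1 : Op (TorusSite d L) 2) +
        ((-1 : ℂ) ^ (∑ i, (x i).val)) • siteSpin 1 x 2))).re := by simp only [hZf, hg']
  have h1 : Zf f₁ = (partitionFn β (hardCoreLatticeGas d L lam)).re := by
    simp only [hZf, hH, hardCoreLatticeGas_eq]
  rw [← hEg, ← h1, hZf₁]
  exact hf₀ g'

end Descent

end Literature.Barriers.AtomisticToContinuum.BoseGas
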